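import Literature.Analysis.OperatorTheory.HilbertSchmidtPairing
import Literature.Analysis.OperatorTheory.L2KernelHilbertSchmidt
import Mathlib.Analysis.MeanInequalities
import Mathlib.Analysis.Normed.Group.Tannery
import HarnessLib

/-!
# Hilbert–Schmidt sums of a composition `‖C K‖₂ ≤ ‖C‖₂ ‖K‖`, Cauchy–Schwarz for the pairing, and continuity
# of the pairing under a strongly convergent family of contractions (Reed–Simon I, Thm. VI.22 (c), (e), (f))

Topic `Literature/Analysis/OperatorTheory`; theorems only (no definition, no named fact, no instance);
continuation of `HilbertSchmidtPairing.lean`.  As there, "`C` is Hilbert–Schmidt" is typed as the convergence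
of `Σ_k ‖C c_k‖²` along a Hilbert basis `(c_k)`.

* `tsum_norm_mul_norm_le_sqrt` — **Cauchy–Schwarz for the pairing**:
  `Σ_i ‖u_i‖‖v_i‖ ≤ (Σ_i ‖u_i‖²)^{1/2} (Σ_i ‖v_i‖²)^{1/2}` (Hölder with `p = q = 2`);
* `summable_norm_sq_apply_of_orthonormal` — `Σ_i ‖T v_i‖² ≤ Σ_k ‖T c_k‖²` for an orthonormal FAMILY `(v_i)`
  (Reed–Simon VI.18: orthonormal partial sums are bounded by the trace);
* **`summable_norm_sq_comp_apply`** — `Σ_i ‖C (K v_i)‖² ≤ ‖K‖² Σ_k ‖C c_k‖²` for `C : F → G` Hilbert–Schmidt,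
  `K : E → F` bounded and `(v_i)` orthonormal in `E` — "`‖C K‖₂ ≤ ‖C‖₂ ‖K‖`" (Reed–Simon VI.22 (f):
  `𝒥₂` is an ideal), through the adjoints `(C K)† = K† C†`;
* `tendsto_tsum_norm_sq_apply_sub` — if `P_a → 1` strongly along a filter, `‖P_a‖ ≤ 1`, and `Σ‖u_k‖² < ∞`,
  then `Σ_k ‖P_a u_k − u_k‖² → 0` (dominated convergence);
* **`tendsto_tsum_inner_comp_strongly`** — for `(v_i)` orthonormal, `Σ‖u_i‖² < ∞`, `C` Hilbert–Schmidt,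
  `K` bounded and contractions `P_a` with ADJOINTS converging strongly to `1`:
  `Σ_i ⟨u_i, C P_a K v_i⟩ → Σ_i ⟨u_i, C K v_i⟩` — the form in which the ultraviolet cutoff `P̂⁰_M → 1` is
  removed INSIDE a Hilbert–Schmidt factor (cell `rh-crit`, Connes 1999 §VII annulus road, hypothesis (W2)).

## References
* M. Reed, B. Simon, *Methods of Modern Mathematical Physics I* (1972), Thm. VI.18, VI.22 (c)–(f), VI.24
  (PDF pp. 196–199 of the held copy). [ReedSimon1972]
-/

noncomputable section

open Filter
open scoped InnerProductSpace Topology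

namespace Literature.Analysis.OperatorTheory

variable {𝕜 : Type*} [RCLike 𝕜]
variable {E F G : Type*} [NormedAddCommGroup E] [InnerProductSpace 𝕜 E] [CompleteSpace E]
  [NormedAddCommGroup F] [InnerProductSpace 𝕜 F] [CompleteSpace F]
  [NormedAddCommGroup G] [InnerProductSpace 𝕜 G] [CompleteSpace G]

/-! ## Cauchy–Schwarz for the pairing -/

/-- **`Σ_i ‖u_i‖‖v_i‖ ≤ (Σ_i ‖u_i‖²)^{1/2} (Σ_i ‖v_i‖²)^{1/2}`** (Hölder with `p = q = 2`). [cite: ReedSimon1972, Thm. VI.22 (c), PDF p. 198] -/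
theorem tsum_norm_mul_norm_le_sqrt {X : Type*} [NormedAddCommGroup X] {ι : Type*} {u v : ι → X}
    (hu : Summable fun i => ‖u i‖ ^ 2) (hv : Summable fun i => ‖v i‖ ^ 2) :
    ∑' i, ‖u i‖ * ‖v i‖ ≤ Real.sqrt (∑' i, ‖u i‖ ^ 2) * Real.sqrt (∑' i, ‖v i‖ ^ 2) := by
  have hu' : Summable fun i => ‖u i‖ ^ (2 : ℝ) := by simpa only [Real.rpow_two] using hu
  have hv' : Summable fun i => ‖v i‖ ^ (2 : ℝ) := by simpa only [Real.rpow_two] using hv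
  have h := Real.inner_le_Lp_mul_Lq_tsum_of_nonneg Real.HolderConjugate.two_two (fun i => norm_nonneg (u i))
    (fun i => norm_nonneg (v i)) hu' hv'
  simp only [Real.rpow_two] at h
  rwa [Real.sqrt_eq_rpow, Real.sqrt_eq_rpow]

/-! ## Hilbert–Schmidt sums along orthonormal families and through a bounded factor -/

/-- **`Σ_i ‖T v_i‖² ≤ Σ_k ‖T c_k‖²` for an orthonormal family `(v_i)`** and a Hilbert basis `(c_k)` (of the same
space): orthonormal partial sums are bounded by the Hilbert–Schmidt sum (Reed–Simon VI.18). [cite: ReedSimon1972, Thm. VI.18, PDF p. 196] -/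
theorem summable_norm_sq_apply_of_orthonormal {ι κ : Type*} (c : HilbertBasis κ 𝕜 F) (T : F →L[𝕜] G)
    (hT : Summable fun k => ‖T (c k)‖ ^ 2) {v : ι → F} (hv : Orthonormal 𝕜 v) :
    Summable (fun i => ‖T (v i)‖ ^ 2) ∧ ∑' i, ‖T (v i)‖ ^ 2 ≤ ∑' k, ‖T (c k)‖ ^ 2 := by
  have hS0 : 0 ≤ ∑' k, ‖T (c k)‖ ^ 2 := tsum_nonneg fun _ => sq_nonneg _
  have henorm : ∀ x : G, ‖x‖ₑ ^ 2 = ENNReal.ofReal (‖x‖ ^ 2) := fun x => by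
    rw [← ofReal_norm, ENNReal.ofReal_pow (norm_nonneg _)]
  have htot : ∑' k, ‖T (c k)‖ₑ ^ 2 = ENNReal.ofReal (∑' k, ‖T (c k)‖ ^ 2) := by
    simp_rw [henorm]
    exact (ENNReal.ofReal_tsum_of_nonneg (fun _ => sq_nonneg _) hT).symm
  have hfin : ∀ s : Finset ι, ∑ i ∈ s, ‖T (v i)‖ ^ 2 ≤ ∑' k, ‖T (c k)‖ ^ 2 := fun s => by
    have h := sum_enorm_sq_apply_le_tsum c T hv s
    rw [htot] at h
    simp_rw [henorm] at h
    rw [← ENNReal.ofReal_sum_of_nonneg (fun _ _ => sq_nonneg _)] at h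
    exact (ENNReal.ofReal_le_ofReal_iff hS0).mp h
  have hsum : Summable fun i => ‖T (v i)‖ ^ 2 := summable_of_sum_le (fun _ => sq_nonneg _) hfin
  exact ⟨hsum, hasSum_le_of_sum_le hsum.hasSum hfin⟩

/-- **`‖C K‖₂ ≤ ‖C‖₂ ‖K‖`** in basis-sum form: for `C : F → G` Hilbert–Schmidt along a Hilbert basis `(c_k)` of
`F`, a bounded `K : E → F` and an orthonormal family `(v_i)` of `E`,
`Σ_i ‖C (K v_i)‖² ≤ ‖K‖² Σ_k ‖C c_k‖²` (through `(C K)† = K† C†` and `Σ‖T† d_j‖² = Σ‖T c_k‖²`;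
Reed–Simon VI.22 (f), `𝒥₂` is a two-sided ideal with `‖AB‖₂ ≤ ‖A‖‖B‖₂`, `‖BA‖₂ ≤ ‖B‖₂‖A‖`). [cite: ReedSimon1972, Thm. VI.22 (f), PDF p. 198] -/
theorem summable_norm_sq_comp_apply {ι κ : Type*} (c : HilbertBasis κ 𝕜 F) (C : F →L[𝕜] G)
    (hC : Summable fun k => ‖C (c k)‖ ^ 2) (K : E →L[𝕜] F) {v : ι → E} (hv : Orthonormal 𝕜 v) :
    Summable (fun i => ‖C (K (v i))‖ ^ 2) ∧ ∑' i, ‖C (K (v i))‖ ^ 2 ≤ ‖K‖ ^ 2 * ∑' k, ‖C (c k)‖ ^ 2 := by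
  obtain ⟨wE, b, -⟩ := exists_hilbertBasis 𝕜 E
  obtain ⟨wG, d, -⟩ := exists_hilbertBasis 𝕜 G
  -- `Σ_j ‖C† d_j‖² = Σ_k ‖C c_k‖²`
  have hCadj : HasSum (fun j => ‖ContinuousLinearMap.adjoint C (d j)‖ ^ 2) (∑' k, ‖C (c k)‖ ^ 2) :=
    (hasSum_norm_sq_adjoint_iff c d C).1 hC.hasSum
  -- `Σ_j ‖K† C† d_j‖² ≤ ‖K‖² Σ_j ‖C† d_j‖²`
  have hle : ∀ j, ‖ContinuousLinearMap.adjoint K (ContinuousLinearMap.adjoint C (d j))‖ ^ 2 ≤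
      ‖K‖ ^ 2 * ‖ContinuousLinearMap.adjoint C (d j)‖ ^ 2 := fun j => by
    rw [← mul_pow]
    gcongr
    calc ‖ContinuousLinearMap.adjoint K (ContinuousLinearMap.adjoint C (d j))‖
        ≤ ‖ContinuousLinearMap.adjoint K‖ * ‖ContinuousLinearMap.adjoint C (d j)‖ :=
          ContinuousLinearMap.le_opNorm _ _
      _ = ‖K‖ * ‖ContinuousLinearMap.adjoint C (d j)‖ := by rw [ContinuousLinearMap.adjoint.norm_map]
  have hadjsum : Summable fun j => ‖ContinuousLinearMap.adjoint K (ContinuousLinearMap.adjoint C (d j))‖ ^ 2 :=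
    Summable.of_nonneg_of_le (fun _ => sq_nonneg _) hle (hCadj.summable.mul_left _)
  have hadjle : ∑' j, ‖ContinuousLinearMap.adjoint K (ContinuousLinearMap.adjoint C (d j))‖ ^ 2 ≤
      ‖K‖ ^ 2 * ∑' k, ‖C (c k)‖ ^ 2 := by
    rw [← hCadj.tsum_eq, ← tsum_mul_left]
    exact hadjsum.tsum_le_tsum hle (hCadj.summable.mul_left _)
  -- back to `C K` along the Hilbert basis `b` of `E`, then to the orthonormal family `v`
  have hCK : HasSum (fun i => ‖(C ∘L K) (b i)‖ ^ 2)
      (∑' j, ‖ContinuousLinearMap.adjoint K (ContinuousLinearMap.adjoint C (d j))‖ ^ 2) := by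
    rw [hasSum_norm_sq_adjoint_iff b d (C ∘L K)]
    simpa only [ContinuousLinearMap.adjoint_comp, ContinuousLinearMap.comp_apply] using hadjsum.hasSum
  have hv' := summable_norm_sq_apply_of_orthonormal b (C ∘L K) hCK.summable hv
  simp only [ContinuousLinearMap.comp_apply] at hv'
  refine ⟨hv'.1, hv'.2.trans ?_⟩
  rw [show (∑' k, ‖C (K (b k))‖ ^ 2) = ∑' j, ‖ContinuousLinearMap.adjoint K (ContinuousLinearMap.adjoint C (d j))‖ ^ 2
    from by simpa only [ContinuousLinearMap.comp_apply] using hCK.tsum_eq]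
  exact hadjle

/-! ## Removing a strongly convergent contraction inside a Hilbert–Schmidt factor -/

/-- If `P_a y → y` for every `y` along a filter, `‖P_a y‖ ≤ ‖y‖`, and `Σ_k ‖u_k‖² < ∞`, then
`Σ_k ‖P_a u_k − u_k‖² → 0` (dominated convergence with the majorant `4‖u_k‖²`). [cite: ReedSimon1972, Thm. VI.22 (e), PDF p. 198] -/
theorem tendsto_tsum_norm_sq_apply_sub {X : Type*} [NormedAddCommGroup X] [NormedSpace 𝕜 X] {α κ : Type*}
    {l : Filter α} (P : α → X →L[𝕜] X) (hP1 : ∀ a y, ‖P a y‖ ≤ ‖y‖)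
    (hP2 : ∀ y, Tendsto (fun a => P a y) l (𝓝 y)) {u : κ → X} (hu : Summable fun k => ‖u k‖ ^ 2) :
    Tendsto (fun a => ∑' k, ‖P a (u k) - u k‖ ^ 2) l (𝓝 0) := by
  have h0 : (0 : ℝ) = ∑' k : κ, (0 : ℝ) := by simp
  rw [h0]
  refine tendsto_tsum_of_dominated_convergence (bound := fun k => 4 * ‖u k‖ ^ 2) (hu.mul_left 4)
    (fun k => ?_) (Eventually.of_forall fun a k => ?_)
  · have h := ((hP2 (u k)).sub_const (u k)).norm
    rw [sub_self, norm_zero] at h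
    simpa using h.pow 2
  · rw [Real.norm_eq_abs, abs_of_nonneg (sq_nonneg _)]
    calc ‖P a (u k) - u k‖ ^ 2 ≤ (‖P a (u k)‖ + ‖u k‖) ^ 2 := by
          gcongr
          exact norm_sub_le _ _
      _ ≤ (‖u k‖ + ‖u k‖) ^ 2 := by
          gcongr
          exact hP1 a (u k)
      _ = 4 * ‖u k‖ ^ 2 := by ring

/-- **Removing the cutoff inside a Hilbert–Schmidt factor**: let `(v_i)` be an orthonormal family of `E`,
`(u_i)` vectors of `G` with `Σ‖u_i‖² < ∞`, `C : F → G` Hilbert–Schmidt, `K : E → F` bounded, and `P_a`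
contractions of `F` whose ADJOINTS converge strongly to the identity along a filter.  Then
`Σ_i ⟨u_i, C P_a K v_i⟩ → Σ_i ⟨u_i, C K v_i⟩`.  (Cauchy–Schwarz: the difference is at most
`(Σ‖u_i‖²)^{1/2} ‖K‖ (Σ_j ‖(P_a† − 1) C† d_j‖²)^{1/2} → 0`.) [cite: ReedSimon1972, Thm. VI.22 (c), (e), (f), PDF p. 198] -/
theorem tendsto_tsum_inner_comp_strongly {ι κ α : Type*} {l : Filter α} (c : HilbertBasis κ 𝕜 F)
    (C : F →L[𝕜] G) (hC : Summable fun k => ‖C (c k)‖ ^ 2) (K : E →L[𝕜] F) {v : ι → E}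
    (hv : Orthonormal 𝕜 v) {u : ι → G} (hu : Summable fun i => ‖u i‖ ^ 2) (P : α → F →L[𝕜] F)
    (hP1 : ∀ a y, ‖ContinuousLinearMap.adjoint (P a) y‖ ≤ ‖y‖)
    (hP2 : ∀ y, Tendsto (fun a => ContinuousLinearMap.adjoint (P a) y) l (𝓝 y)) :
    Tendsto (fun a => ∑' i, ⟪u i, C (P a (K (v i)))⟫_𝕜) l (𝓝 (∑' i, ⟪u i, C (K (v i))⟫_𝕜)) := by
  obtain ⟨wG, d, -⟩ := exists_hilbertBasis 𝕜 G
  -- the Hilbert–Schmidt data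
  have hCadj : Summable fun j => ‖ContinuousLinearMap.adjoint C (d j)‖ ^ 2 :=
    ((hasSum_norm_sq_adjoint_iff c d C).1 hC.hasSum).summable
  -- `ε_a := Σ_j ‖(P_a† − 1) C† d_j‖² → 0`
  have hε := tendsto_tsum_norm_sq_apply_sub (fun a => ContinuousLinearMap.adjoint (P a)) hP1 hP2 hCadj
  -- the operators `D_a := C (P_a − 1)` are Hilbert–Schmidt along `c` with sum `ε_a`
  have hD : ∀ a, HasSum (fun k => ‖(C ∘L (P a - 1)) (c k)‖ ^ 2)
      (∑' j, ‖ContinuousLinearMap.adjoint (P a) (ContinuousLinearMap.adjoint C (d j)) -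
        ContinuousLinearMap.adjoint C (d j)‖ ^ 2) := fun a => by
    rw [hasSum_norm_sq_adjoint_iff c d]
    have hs : Summable fun j => ‖ContinuousLinearMap.adjoint (P a) (ContinuousLinearMap.adjoint C (d j)) -
        ContinuousLinearMap.adjoint C (d j)‖ ^ 2 := by
      refine Summable.of_nonneg_of_le (fun _ => sq_nonneg _) (fun j => ?_) (hCadj.mul_left 4)
      calc ‖ContinuousLinearMap.adjoint (P a) (ContinuousLinearMap.adjoint C (d j)) -
            ContinuousLinearMap.adjoint C (d j)‖ ^ 2
          ≤ (‖ContinuousLinearMap.adjoint (P a) (ContinuousLinearMap.adjoint C (d j))‖ +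
              ‖ContinuousLinearMap.adjoint C (d j)‖) ^ 2 := by gcongr; exact norm_sub_le _ _
        _ ≤ (‖ContinuousLinearMap.adjoint C (d j)‖ + ‖ContinuousLinearMap.adjoint C (d j)‖) ^ 2 := by
            gcongr; exact hP1 a _
        _ = 4 * ‖ContinuousLinearMap.adjoint C (d j)‖ ^ 2 := by ring
    have hadj : ContinuousLinearMap.adjoint (P a - 1) = ContinuousLinearMap.adjoint (P a) - 1 := by
      rw [← ContinuousLinearMap.star_eq_adjoint, star_sub, star_one, ContinuousLinearMap.star_eq_adjoint]
    refine hs.hasSum.congr_fun fun j => ?_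
    rw [ContinuousLinearMap.adjoint_comp, hadj, ContinuousLinearMap.comp_apply, sub_apply,
      one_apply_eq_self]
  -- Hilbert–Schmidt data of `C K` and `D_a K` along `v`
  have hCK := (summable_norm_sq_comp_apply c C hC K hv).1
  have hS : Summable fun i => ⟪u i, C (K (v i))⟫_𝕜 := summable_inner_of_summable_norm_sq hu hCK
  set ε : α → ℝ := fun a => ∑' j, ‖ContinuousLinearMap.adjoint (P a) (ContinuousLinearMap.adjoint C (d j)) -
    ContinuousLinearMap.adjoint C (d j)‖ ^ 2 with hεdef
  have hDK : ∀ a, Summable (fun i => ‖(C ∘L (P a - 1)) (K (v i))‖ ^ 2) ∧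
      ∑' i, ‖(C ∘L (P a - 1)) (K (v i))‖ ^ 2 ≤ ‖K‖ ^ 2 * ε a := fun a => by
    have h := summable_norm_sq_comp_apply c (C ∘L (P a - 1)) (hD a).summable K hv
    rw [(hD a).tsum_eq] at h
    exact h
  -- the bound `‖S_a − S‖ ≤ (Σ‖u_i‖²)^{1/2} (‖K‖² ε_a)^{1/2}`
  have hbound : ∀ a, ‖(∑' i, ⟪u i, C (P a (K (v i)))⟫_𝕜) - ∑' i, ⟪u i, C (K (v i))⟫_𝕜‖ ≤
      Real.sqrt (∑' i, ‖u i‖ ^ 2) * Real.sqrt (‖K‖ ^ 2 * ε a) := fun a => by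
    have hPa := (summable_norm_sq_comp_apply c C hC (P a ∘L K) hv).1
    simp only [ContinuousLinearMap.comp_apply] at hPa
    have hSa : Summable fun i => ⟪u i, C (P a (K (v i)))⟫_𝕜 := summable_inner_of_summable_norm_sq hu hPa
    rw [← hSa.tsum_sub hS]
    have hdiff : ∀ i, ⟪u i, C (P a (K (v i)))⟫_𝕜 - ⟪u i, C (K (v i))⟫_𝕜 =
        ⟪u i, (C ∘L (P a - 1)) (K (v i))⟫_𝕜 := fun i => by
      rw [← inner_sub_right, ContinuousLinearMap.comp_apply, sub_apply, map_sub,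
        one_apply_eq_self]
    simp_rw [hdiff]
    refine (norm_tsum_inner_le hu (hDK a).1).trans ((tsum_norm_mul_norm_le_sqrt hu (hDK a).1).trans ?_)
    gcongr
    exact (hDK a).2
  -- conclude by squeezing
  rw [tendsto_iff_norm_sub_tendsto_zero]
  refine squeeze_zero (fun a => norm_nonneg _) hbound ?_
  have h0 : Tendsto (fun a => Real.sqrt (∑' i, ‖u i‖ ^ 2) * Real.sqrt (‖K‖ ^ 2 * ε a)) l
      (𝓝 (Real.sqrt (∑' i, ‖u i‖ ^ 2) * Real.sqrt (‖K‖ ^ 2 * 0))) :=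
    tendsto_const_nhds.mul ((tendsto_const_nhds.mul hε).sqrt)
  rwa [mul_zero, Real.sqrt_zero, mul_zero] at h0

end Literature.Analysis.OperatorTheory
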